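/-
Copyright (c) 2026 the pub-hodgecm-mathlib formalisation cell (harness21).  Prover seat hodgecm-mathlib-K2E3-p23 (g6), HCML Track B «K2-LIT» ∕ h413
(`stmt-HodgeConjecture-24833`), line `K2_E3_EllipticInputs`, road «GL₂-sc» (road owner K2E5-p17 (g5), dealer K2E3-plan (g4)), NON-ELLIPTIC half, brick 2N-2,
FILE 2 OF 3 (V2₂): the `N = 2` SHEAR COUNT — for `t = diag(t₀, t₁)` regular with integral entries and any Haar measure `μ_N` of the upper unitriangular group
`N₂ ≤ GL₂(F)`: `μ_N {n : 𝔅_m(n t n⁻¹)} ≤ |t₀ − t₁|_F⁻¹ · μ_N(N-box m)` (the `Fin 2` reading of ★ (V2) `K2E3GL3SplitShearCount`, K2E3-p14 (g5)).  2026-09-04.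
-/
import Summits.HodgeConjecture.HodgeConjecture.Theorems.K2E3GL3SplitShearCount        -- ★ (V2) (K2E3-p14 g5): frame (`unipotentRadicalGL`, `glDiagonal`, `normAbs`, ★ V0 `K2E3GLnUnipotentAdHeight`, ★ B4-0 generic `isCompact_setOf_scaled_integral`, `isOpen_setOf_adBall`)
import Literature.NumberTheory.Automorphic.GLnMaximalParabolicLocalModulus               -- ★ `isHaarMeasure_map_of_map_add` (Haar along `(V,+) ≅ N`)
import Literature.NumberTheory.Automorphic.TateLocalZetaShells                           -- ★ `addHaar_smul_set` (`μ(a • s) = |a| μ(s)`)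
import Mathlib.MeasureTheory.Measure.Haar.Unique
import HarnessLib

/-!
# Road «GL₂-sc», non-elliptic half, brick 2N-2 (V2₂): the shear count on `N₂ ≅ F`

Cell `pub/hodgecm-mathlib` (D-0151), Track B «K2-LIT», crux H413 = `stmt-HodgeConjecture-24833`, route of record `HCCMUnconditional`.  Lane
`--supports stmt-HodgeConjecture-24833 --as helper`; THEOREMS ONLY (no `def`, no `instance`, no `notation`, no named-fact hypothesis, no `sorry`); count-neutral.
The `n`-range of the `k · n · a` volume count of Harish-Chandra's ball bound [HarishChandra1970, Part VII §3 p. 72] at `GL₂`: the upper unitriangular group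
`N₂ = unipotentRadicalGL F id = {[[1, x], [0, 1]]}` is the additive group `F` in the coordinate `x` (`exists_coordHomeomorph`, `coord_add`), every Haar measure of
`N₂` is `C • e_* dx` (`exists_haar_eq_smul_map_coord`, ★ `isHaarMeasure_map_of_map_add` + Haar uniqueness), and conjugating the regular diagonal `t = diag(t₀, t₁)` by
`n(x)` is the SHEAR `n(x) t n(x)⁻¹ = n(c x) · t` with `c = 1 − t₀∕t₁` (`coord_conj_glDiagonal`); so `{n : 𝔅_m(n t n⁻¹)} ⊆ n(c⁻¹ · e⁻¹(N-box m))` (★ V0: `𝔅_m(n' t) ⇒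
n' ∈ N-box(m)`) and Tate's `dx(c⁻¹ • S) = |c|⁻¹ dx(S)` [Tate1950, §2.2 Lemma 2.2.5] with `|c| = |t₁ − t₀| ∕ |t₁| ≥ |t₀ − t₁|` give
  **`μ_N {n : 𝔅_m(n t n⁻¹)} ≤ |t₀ − t₁|_F⁻¹ · μ_N {n : |ϖ^m n_{ij}| ≤ 1 ∀ i j}`**   (`measure_setOf_adBall_conj_diagonal_le`)
— `|D(t)|^{−1∕2}` times a LOCAL constant (the N-box is compact, `isCompact_nBox`, `measure_nBox_lt_top`), the `N = 2` case of Rogawski's substitution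
[Rogawski1990, §4.13, proof of Lemma 4.13.1, p. 70] used by ★ (V2) at `N = 3`.
* §1 entries of `n ∈ N₂` and of `n⁻¹` (`coe_eq_of_mem`, `inv_apply_eq_of_mem`, `v_pow_mul_inv_apply_le_one_of_mem`);
* §2 the coordinate `e : R ≃ₜ N₂` (`exists_coordHomeomorph`, `coord_add`, `coord_conj_glDiagonal`);
* §3 the N-box (`isCompact_nBox`, `measure_nBox_lt_top`); §4 Haar (`exists_haar_eq_smul_map_coord`); §5 the count.
HONEST LABEL: HC_CM is proved only modulo the 7 printed citations (2 remaining named inputs: hLiu418 = stmt-HodgeConjecture-24832, h413 =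
stmt-HodgeConjecture-24833) until rung 0 closes; count-neutral helper.

## References
* [HarishChandra1970] Harish-Chandra (notes by G. van Dijk), *Harmonic Analysis on Reductive p-adic Groups*, LNM 162 (1970), Part VII §3 p. 72.
* [Rogawski1990] J. Rogawski, *Automorphic Representations of Unitary Groups in Three Variables* (1990), §4.13, Lemma 4.13.1, p. 70.
* [Tate1950] J. Tate, *Fourier analysis in number fields and Hecke's zeta-functions* (1950), §2.2 Lemma 2.2.5.
* [BernsteinZelevinsky1976] I. N. Bernstein, A. V. Zelevinsky, *Representations of the group GL(n,F) where F is a non-archimedean local field* (1976), §1.18–1.19.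
-/

set_option linter.dupNamespace false

noncomputable section

open MeasureTheory Measure Set Function Topology TopologicalSpace
open scoped MatrixGroups NNReal ENNReal WithZero Pointwise
open Matrix ValuativeRel
open Literature.NumberTheory.Automorphic Literature.NumberTheory.GaloisRepresentations Literature.NumberTheory.GaloisRepresentations.IsNonarchimedeanLocalField
open Summit.HodgeConjecture.HodgeConjecture.Cruxes.H413.K2E3GLnAdHeightBalls Summit.HodgeConjecture.HodgeConjecture.Cruxes.H413.K2E3GLnUnipotentAdHeight
open Summit.HodgeConjecture.HodgeConjecture.Cruxes.H413.K2E3GL3HeightBallExhaustion (isCompact_setOf_scaled_integral)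

namespace Summit.HodgeConjecture.HodgeConjecture.Cruxes.H413.K2E3GL2SplitShearCount

/-! ## §1 Entries of `n ∈ N₂` and of `n⁻¹` -/

section Entries

variable {F : Type*} [CommRing F]

/-- A unitriangular element has unit diagonal. [folklore] -/
theorem apply_self_eq_one_of_mem {n : GL (Fin 2) F} (hn : n ∈ unipotentRadicalGL F (id : Fin 2 → Fin 2)) (j : Fin 2) :
    (n : Matrix (Fin 2) (Fin 2) F) j j = 1 := by
  have h := ((mem_unipotentRadicalGL_iff_entry (R := F) (c := (id : Fin 2 → Fin 2)) n).1 hn).2 j j rfl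
  rw [h, Matrix.one_apply_eq]

/-- A unitriangular element vanishes below the diagonal. [folklore] -/
theorem apply_eq_zero_of_mem {n : GL (Fin 2) F} (hn : n ∈ unipotentRadicalGL F (id : Fin 2 → Fin 2)) {i j : Fin 2} (hji : j < i) :
    (n : Matrix (Fin 2) (Fin 2) F) i j = 0 := by
  have h : (n : Matrix (Fin 2) (Fin 2) F).BlockTriangular (id : Fin 2 → Fin 2) :=
    ((mem_unipotentRadicalGL_iff_entry (R := F) (c := (id : Fin 2 → Fin 2)) n).1 hn).1
  exact h hji

/-- **`n ∈ N₂` is `[[1, n₀₁], [0, 1]]`.** [cite: BernsteinZelevinsky1976, §1.18] -/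
theorem coe_eq_of_mem {n : GL (Fin 2) F} (hn : n ∈ unipotentRadicalGL F (id : Fin 2 → Fin 2)) :
    (n : Matrix (Fin 2) (Fin 2) F) = !![1, (n : Matrix (Fin 2) (Fin 2) F) 0 1; 0, 1] := by
  ext i j
  fin_cases i <;> fin_cases j
  · exact apply_self_eq_one_of_mem hn 0
  · rfl
  · exact apply_eq_zero_of_mem hn (by decide)
  · exact apply_self_eq_one_of_mem hn 1

/-- A unit of the shape `[[1, x], [0, 1]]` lies in `N₂`. [cite: BernsteinZelevinsky1976, §1.18] -/
theorem mem_of_coe_eq {g : GL (Fin 2) F} {x : F} (hg : (g : Matrix (Fin 2) (Fin 2) F) = !![1, x; 0, 1]) :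
    g ∈ unipotentRadicalGL F (id : Fin 2 → Fin 2) := by
  rw [mem_unipotentRadicalGL_iff_entry]
  refine ⟨fun i j hij => ?_, fun i j hij => ?_⟩
  · rw [hg]
    fin_cases i <;> fin_cases j <;> first | rfl | exact absurd hij (by decide)
  · simp only [id_eq] at hij
    subst hij
    rw [hg, Matrix.one_apply_eq]
    fin_cases i <;> rfl

/-- **The inverse of `n = [[1, x], [0, 1]]` has upper entry `−x`.** [folklore] -/
theorem inv_apply_eq_of_mem {n : GL (Fin 2) F} (hn : n ∈ unipotentRadicalGL F (id : Fin 2 → Fin 2)) :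
    ((n⁻¹ : GL (Fin 2) F) : Matrix (Fin 2) (Fin 2) F) 0 1 = -(n : Matrix (Fin 2) (Fin 2) F) 0 1 := by
  have hn' : n⁻¹ ∈ unipotentRadicalGL F (id : Fin 2 → Fin 2) := Subgroup.inv_mem _ hn
  set X : Matrix (Fin 2) (Fin 2) F := (n : Matrix (Fin 2) (Fin 2) F) with hX
  set P : Matrix (Fin 2) (Fin 2) F := ((n⁻¹ : GL (Fin 2) F) : Matrix (Fin 2) (Fin 2) F) with hP
  have hmul : X * P = 1 := by rw [hX, hP, ← Units.val_mul, mul_inv_cancel, Units.val_one]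
  have hX00 : X 0 0 = 1 := apply_self_eq_one_of_mem hn 0
  have hP11 : P 1 1 = 1 := apply_self_eq_one_of_mem hn' 1
  have e01 := congrFun (congrFun hmul 0) 1
  rw [Matrix.mul_apply, Fin.sum_univ_two, Matrix.one_apply_ne (by decide), hX00, hP11] at e01
  linear_combination e01

variable [Valued F ℤᵐ⁰]

/-- **`|ϖ^m n_{ij}| ≤ 1 ∀ ⇒ |ϖ^m (n⁻¹)_{kl}| ≤ 1 ∀`** for `n ∈ N₂`: the entries of `n⁻¹` are `1`, `0`, `−n₀₁`. [folklore] -/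
theorem v_pow_mul_inv_apply_le_one_of_mem {ϖ : F} {m : ℕ} {n : GL (Fin 2) F} (hn : n ∈ unipotentRadicalGL F (id : Fin 2 → Fin 2))
    (hb : ∀ i j, Valued.v (ϖ ^ m * (n : Matrix (Fin 2) (Fin 2) F) i j) ≤ 1) (k l : Fin 2) :
    Valued.v (ϖ ^ m * ((n⁻¹ : GL (Fin 2) F) : Matrix (Fin 2) (Fin 2) F) k l) ≤ 1 := by
  have hn' : n⁻¹ ∈ unipotentRadicalGL F (id : Fin 2 → Fin 2) := Subgroup.inv_mem _ hn
  have h2 : ∀ i : Fin 2, i = 0 ∨ i = 1 := by decide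
  rcases h2 k with rfl | rfl <;> rcases h2 l with rfl | rfl
  · rw [apply_self_eq_one_of_mem hn' 0, ← apply_self_eq_one_of_mem hn 0]; exact hb 0 0
  · rw [inv_apply_eq_of_mem hn, mul_neg, Valuation.map_neg]; exact hb 0 1
  · rw [apply_eq_zero_of_mem hn' (by decide), mul_zero, map_zero]; exact zero_le
  · rw [apply_self_eq_one_of_mem hn' 1, ← apply_self_eq_one_of_mem hn 1]; exact hb 1 1

end Entries

/-! ## §2 The coordinate `e : R ≃ₜ N₂`, `e(x) = [[1, x], [0, 1]]` -/

section Coord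

variable {R : Type*} [CommRing R] [TopologicalSpace R] [IsTopologicalRing R]

/-- **Coordinates on `N₂`**: a homeomorphism `e : R ≃ₜ U_id(GL₂(R))` with `↑(e x) = [[1, x], [0, 1]]` (inverse `u ↦ u₀₁`). [cite: BernsteinZelevinsky1976, §1.18] -/
theorem exists_coordHomeomorph :
    ∃ e : R ≃ₜ ↥(unipotentRadicalGL R (id : Fin 2 → Fin 2)),
      ∀ x : R, (((e x : ↥(unipotentRadicalGL R (id : Fin 2 → Fin 2))) : GL (Fin 2) R) : Matrix (Fin 2) (Fin 2) R) = !![1, x; 0, 1] := by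
  have hmul : ∀ x : R, (!![1, x; 0, 1] : Matrix (Fin 2) (Fin 2) R) * !![1, -x; 0, 1] = 1 := fun x => by
    ext i j
    fin_cases i <;> fin_cases j <;> simp [Matrix.mul_apply, Fin.sum_univ_two]
  have hmul' : ∀ x : R, (!![1, -x; 0, 1] : Matrix (Fin 2) (Fin 2) R) * !![1, x; 0, 1] = 1 := fun x => by
    ext i j
    fin_cases i <;> fin_cases j <;> simp [Matrix.mul_apply, Fin.sum_univ_two]
  have hmem : ∀ x : R, (⟨!![1, x; 0, 1], !![1, -x; 0, 1], hmul x, hmul' x⟩ : GL (Fin 2) R) ∈ unipotentRadicalGL R (id : Fin 2 → Fin 2) :=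
    fun x => by
      apply mem_of_coe_eq (x := x)
      rfl
  refine ⟨{ toFun := fun x => ⟨_, hmem x⟩,
             invFun := fun u => (((u : GL (Fin 2) R)) : Matrix (Fin 2) (Fin 2) R) 0 1,
             left_inv := fun x => by simp,
             right_inv := fun u => Subtype.ext (Units.ext (coe_eq_of_mem u.2).symm),
             continuous_toFun := ?_,
             continuous_invFun := ?_ }, fun x => rfl⟩
  · refine Continuous.subtype_mk (Units.continuous_iff.2 ⟨?_, ?_⟩) _
    · refine continuous_matrix fun i j => ?_
      fin_cases i <;> fin_cases j <;> simp <;> fun_prop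
    · refine continuous_matrix fun i j => ?_
      fin_cases i <;> fin_cases j <;> simp <;> fun_prop
  · exact (Units.continuous_val.comp continuous_subtype_val).matrix_elem 0 1

variable (e : R ≃ₜ ↥(unipotentRadicalGL R (id : Fin 2 → Fin 2)))
  (he : ∀ x : R, (((e x : ↥(unipotentRadicalGL R (id : Fin 2 → Fin 2))) : GL (Fin 2) R) : Matrix (Fin 2) (Fin 2) R) = !![1, x; 0, 1])
include he

omit [IsTopologicalRing R] in
/-- **The group law in the coordinate is addition**: `e(x + y) = e(x) · e(y)`. [cite: BernsteinZelevinsky1976, §1.18] -/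
theorem coord_add (x y : R) : e (x + y) = e x * e y := by
  apply Subtype.ext
  apply Units.ext
  rw [Subgroup.coe_mul, Units.val_mul, he, he, he]
  ext i j
  fin_cases i <;> fin_cases j <;> simp [Matrix.mul_apply, Fin.sum_univ_two]
  ring

omit [IsTopologicalRing R] in
/-- **THE SHEAR**: `e(x) · t · e(x)⁻¹ = e((1 − t₀ t₁⁻¹) x) · t` for `t = diag(t₀, t₁)`. [cite: Rogawski1990, §4.13 p. 70] -/
theorem coord_conj_glDiagonal (t : Fin 2 → Rˣ) (x : R) :
    ((e x : ↥(unipotentRadicalGL R (id : Fin 2 → Fin 2))) : GL (Fin 2) R) * glDiagonal 2 R t * (((e x : ↥(unipotentRadicalGL R (id : Fin 2 → Fin 2))) : GL (Fin 2) R))⁻¹ =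
      ((e ((1 - (t 0 : R) * ((t 1)⁻¹ : Rˣ)) * x) : ↥(unipotentRadicalGL R (id : Fin 2 → Fin 2))) : GL (Fin 2) R) * glDiagonal 2 R t := by
  rw [mul_inv_eq_iff_eq_mul]
  apply Units.ext
  have hs : (((t 1)⁻¹ : Rˣ) : R) * (t 1 : R) = 1 := Units.inv_mul _
  rw [Units.val_mul, Units.val_mul, Units.val_mul, he, he, coe_glDiagonal]
  ext i j
  simp only [Matrix.mul_apply, Fin.sum_univ_two]
  fin_cases i <;> fin_cases j <;> simp [Matrix.diagonal_apply_eq, Matrix.diagonal_apply_ne]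
  linear_combination ((t 0 : R) * x) * hs

end Coord

/-! ## §3 The `N`-box is compact, of finite Haar measure -/

section Box

variable {F : Type*} [Field F] [Valued F ℤᵐ⁰] [ValuativeRel F] [(Valued.v : Valuation F ℤᵐ⁰).Compatible] [IsNonarchimedeanLocalField F]

/-- **THE `N`-BOX OF RADIUS `m` IS COMPACT**: `{n ∈ N₂ : |ϖ^m n_{ij}| ≤ 1 ∀ i j}` is a closed subset of the compact GL-ball `{ϖ^m g, ϖ^m g⁻¹ integral}` ★.
[cite: HarishChandra1970, Part VII §2 p. 69] -/
theorem isCompact_nBox {ϖ : F} (hϖ : Valued.v ϖ = WithZero.exp (-1 : ℤ)) (m : ℕ) :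
    IsCompact {n : ↥(unipotentRadicalGL F (id : Fin 2 → Fin 2)) | ∀ i j, Valued.v (ϖ ^ m * ((n : GL (Fin 2) F) : Matrix (Fin 2) (Fin 2) F) i j) ≤ 1} := by
  haveI : IsTopologicalRing F := inferInstance
  haveI : T2Space F := (isLocalField F).toT2Space
  have hϖ0 : ϖ ≠ 0 := ne_zero_of_v_eq_exp hϖ
  rw [Subtype.isCompact_iff]
  have hsub : ((↑) : ↥(unipotentRadicalGL F (id : Fin 2 → Fin 2)) → GL (Fin 2) F) ''
      {n : ↥(unipotentRadicalGL F (id : Fin 2 → Fin 2)) | ∀ i j, Valued.v (ϖ ^ m * ((n : GL (Fin 2) F) : Matrix (Fin 2) (Fin 2) F) i j) ≤ 1} =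
      (unipotentRadicalGL F (id : Fin 2 → Fin 2) : Set (GL (Fin 2) F)) ∩ {g : GL (Fin 2) F | ∀ i j, Valued.v (ϖ ^ m * (g : Matrix (Fin 2) (Fin 2) F) i j) ≤ 1} := by
    ext g
    constructor
    · rintro ⟨n, hn, rfl⟩; exact ⟨n.2, hn⟩
    · rintro ⟨hg, hb⟩; exact ⟨⟨g, hg⟩, hb, rfl⟩
  rw [hsub]
  refine (isCompact_setOf_scaled_integral (n := Fin 2) hϖ0 m m).of_isClosed_subset ?_ ?_
  · refine (isClosed_unipotentRadicalGL (R := F) (id : Fin 2 → Fin 2)).inter ?_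
    have hC : IsClosed {x : F | Valued.v x ≤ 1} := Valued.isClosed_integer F
    simp only [Set.setOf_forall]
    exact isClosed_iInter fun i => isClosed_iInter fun j => hC.preimage (continuous_const.mul (Units.continuous_val.matrix_elem i j))
  · rintro g ⟨hg, hb⟩
    exact ⟨hb, v_pow_mul_inv_apply_le_one_of_mem hg hb⟩

/-- The `N`-box has FINITE measure for every measure finite on compacta (e.g. a Haar measure of `N₂`) — the local constant `c(m)` of the volume count.
[cite: HarishChandra1970, Part VII §3 p. 72] -/
theorem measure_nBox_lt_top {ϖ : F} (hϖ : Valued.v ϖ = WithZero.exp (-1 : ℤ)) (m : ℕ)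
    [MeasurableSpace (GL (Fin 2) F)] [BorelSpace (GL (Fin 2) F)]
    (μN : Measure ↥(unipotentRadicalGL F (id : Fin 2 → Fin 2))) [IsFiniteMeasureOnCompacts μN] :
    μN {n | ∀ i j, Valued.v (ϖ ^ m * ((n : GL (Fin 2) F) : Matrix (Fin 2) (Fin 2) F) i j) ≤ 1} < ⊤ :=
  (isCompact_nBox hϖ m).measure_lt_top

end Box

/-! ## §4 Every Haar measure of `N₂` is `C • e_* dx` -/

section Haar

variable {F : Type*} [Field F] [Valued F ℤᵐ⁰] [ValuativeRel F] [(Valued.v : Valuation F ℤᵐ⁰).Compatible] [IsNonarchimedeanLocalField F]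
  [MeasurableSpace F] [BorelSpace F] [MeasurableSpace (GL (Fin 2) F)] [BorelSpace (GL (Fin 2) F)]

omit [(Valued.v : Valuation F ℤᵐ⁰).Compatible] in
/-- **Every Haar measure on `N₂` is `C • e_* dx`, `C ≠ 0`**, for `dx` an additive Haar measure of `F` and `e` the coordinate (★ `isHaarMeasure_map_of_map_add`: `e_* dx`
is a Haar measure since `e(x + y) = e(x) e(y)`; uniqueness of Haar measure on the second countable locally compact group `N₂`). [cite: BernsteinZelevinsky1976, §1.19] -/
theorem exists_haar_eq_smul_map_coord (e : F ≃ₜ ↥(unipotentRadicalGL F (id : Fin 2 → Fin 2)))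
    (he : ∀ x : F, (((e x : ↥(unipotentRadicalGL F (id : Fin 2 → Fin 2))) : GL (Fin 2) F) : Matrix (Fin 2) (Fin 2) F) = !![1, x; 0, 1])
    (μF : Measure F) [μF.IsAddHaarMeasure] (μN : Measure ↥(unipotentRadicalGL F (id : Fin 2 → Fin 2))) [IsHaarMeasure μN] :
    ∃ C : ℝ≥0, C ≠ 0 ∧ μN = C • μF.map e := by
  haveI : T2Space F := (isLocalField F).toT2Space
  haveI : LocallyCompactSpace F := (isLocalField F).toLocallyCompactSpace
  haveI : SecondCountableTopology F := secondCountableTopology_localField F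
  haveI : IsTopologicalRing F := inferInstance
  haveI : BorelSpace ↥(unipotentRadicalGL F (id : Fin 2 → Fin 2)) := Subtype.borelSpace _
  haveI : SecondCountableTopology ↥(unipotentRadicalGL F (id : Fin 2 → Fin 2)) := e.symm.secondCountableTopology
  haveI : LocallyCompactSpace ↥(unipotentRadicalGL F (id : Fin 2 → Fin 2)) := e.symm.isClosedEmbedding.locallyCompactSpace
  haveI : IsHaarMeasure (μF.map e) := isHaarMeasure_map_of_map_add e (coord_add e he) μF
  exact ⟨haarScalarFactor μN (μF.map e), (haarScalarFactor_pos_of_isHaarMeasure _ _).ne', isMulLeftInvariant_eq_smul μN _⟩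

end Haar

/-! ## §5 The shear count -/

section Count

variable {F : Type*} [Field F] [Valued F ℤᵐ⁰] [ValuativeRel F] [(Valued.v : Valuation F ℤᵐ⁰).Compatible] [IsNonarchimedeanLocalField F]
  [MeasurableSpace (GL (Fin 2) F)] [BorelSpace (GL (Fin 2) F)]

/-- **THE SHEAR COUNT AT `N = 2`.**  For `t = diag(t₀, t₁)` with distinct INTEGRAL entries and every Haar measure `μ_N` of the upper unitriangular group `N₂ ≤ GL₂(F)`:
`μ_N {n : 𝔅_m(n t n⁻¹)} ≤ |t₀ − t₁|_F⁻¹ · μ_N {n : |ϖ^m n_{ij}| ≤ 1 ∀ i j}` — the shear `n(x) t n(x)⁻¹ = n(c x) t`, `c = 1 − t₀∕t₁`, Tate's `dx(c⁻¹ • S) = |c|⁻¹ dx(S)`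
with `|c| = |t₀ − t₁| ∕ |t₁| ≥ |t₀ − t₁|`, then ★ V0 `𝔅_m(n' t) ⇒ n' ∈ N-box(m)`.
[cite: HarishChandra1970, Part VII §3 p. 72] [cite: Rogawski1990, §4.13, proof of Lemma 4.13.1, p. 70] [cite: Tate1950, §2.2 Lemma 2.2.5] -/
theorem measure_setOf_adBall_conj_diagonal_le (μN : Measure ↥(unipotentRadicalGL F (id : Fin 2 → Fin 2))) [IsHaarMeasure μN]
    (t : Fin 2 → Fˣ) (h01 : (t 0 : F) ≠ t 1) (ht1 : ∀ i, Valued.v (t i : F) ≤ 1) (ϖ : F) (m : ℕ) :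
    μN {n | ∀ i j k l, Valued.v (ϖ ^ m * ((((n : GL (Fin 2) F) * glDiagonal 2 F t * ((n : GL (Fin 2) F))⁻¹ : GL (Fin 2) F) : Matrix (Fin 2) (Fin 2) F) i j *
        ((((n : GL (Fin 2) F) * glDiagonal 2 F t * ((n : GL (Fin 2) F))⁻¹)⁻¹ : GL (Fin 2) F) : Matrix (Fin 2) (Fin 2) F) k l)) ≤ 1} ≤
      ((normAbs F ((t 0 : F) - t 1))⁻¹ : ℝ≥0) *
        μN {n | ∀ i j, Valued.v (ϖ ^ m * ((n : GL (Fin 2) F) : Matrix (Fin 2) (Fin 2) F) i j) ≤ 1} := by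
  classical
  haveI : T2Space F := (isLocalField F).toT2Space
  haveI : LocallyCompactSpace F := (isLocalField F).toLocallyCompactSpace
  haveI : SecondCountableTopology F := secondCountableTopology_localField F
  haveI : IsTopologicalRing F := inferInstance
  haveI : BorelSpace ↥(unipotentRadicalGL F (id : Fin 2 → Fin 2)) := Subtype.borelSpace _
  letI : MeasurableSpace F := borel F
  haveI : BorelSpace F := ⟨rfl⟩
  set μF : Measure F := Measure.addHaar with hμF
  obtain ⟨e, he⟩ := exists_coordHomeomorph (R := F)
  obtain ⟨C, -, hμN⟩ := exists_haar_eq_smul_map_coord e he μF μN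
  -- measures of sets of `N₂` read in the coordinate
  have hread : ∀ S : Set ↥(unipotentRadicalGL F (id : Fin 2 → Fin 2)), μN S = C * μF (e ⁻¹' S) := fun S => by
    rw [hμN, Measure.smul_apply, ← e.toMeasurableEquiv_coe, MeasurableEquiv.map_apply, ENNReal.smul_def, smul_eq_mul]
  set γ : GL (Fin 2) F := glDiagonal 2 F t with hγ
  set S : Set ↥(unipotentRadicalGL F (id : Fin 2 → Fin 2)) := {n | ∀ i j k l, Valued.v (ϖ ^ m *
      ((((n : GL (Fin 2) F) * γ * ((n : GL (Fin 2) F))⁻¹ : GL (Fin 2) F) : Matrix (Fin 2) (Fin 2) F) i j *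
        ((((n : GL (Fin 2) F) * γ * ((n : GL (Fin 2) F))⁻¹)⁻¹ : GL (Fin 2) F) : Matrix (Fin 2) (Fin 2) F) k l)) ≤ 1} with hS
  set B : Set ↥(unipotentRadicalGL F (id : Fin 2 → Fin 2)) := {n | ∀ i j, Valued.v (ϖ ^ m * ((n : GL (Fin 2) F) : Matrix (Fin 2) (Fin 2) F) i j) ≤ 1} with hB
  -- the shear constant `c = 1 − t₀∕t₁ ≠ 0`, `|c|⁻¹ ≤ |t₀ − t₁|⁻¹`
  set c : F := 1 - (t 0 : F) * ((t 1)⁻¹ : Fˣ) with hc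
  have hct : c * (t 1 : F) = (t 1 : F) - t 0 := by
    rw [hc, sub_mul, one_mul, mul_assoc, Units.inv_mul, mul_one]
  have hc0 : c ≠ 0 := by
    intro h0
    rw [h0, zero_mul, eq_comm, sub_eq_zero] at hct
    exact h01 hct.symm
  have hcinv : normAbs F c⁻¹ ≤ (normAbs F ((t 0 : F) - t 1))⁻¹ := by
    have hΔ0 : (t 0 : F) - t 1 ≠ 0 := sub_ne_zero.2 h01
    have hΔpos : 0 < normAbs F ((t 0 : F) - t 1) := pos_iff_ne_zero.2 ((map_ne_zero (normAbs F)).2 hΔ0)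
    have hle : normAbs F ((t 0 : F) - t 1) ≤ normAbs F c := by
      have h1 : normAbs F (c * (t 1 : F)) = normAbs F ((t 0 : F) - t 1) := by
        rw [hct, ← neg_sub, normAbs_apply, normAbs_apply, Valuation.map_neg]
      have ht1' : normAbs F (t 1 : F) ≤ 1 := by
        rw [normAbs_le_one_iff, ← v_le_one_iff_mem_integer]; exact ht1 1
      rw [← h1, map_mul]
      exact mul_le_of_le_one_right zero_le ht1'
    rw [map_inv₀]
    exact inv_anti₀ hΔpos hle
  -- the key inclusion `e⁻¹ S ⊆ c⁻¹ • e⁻¹ B`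
  have hsub : e ⁻¹' S ⊆ c⁻¹ • (e ⁻¹' B) := by
    intro x hx
    rw [Set.mem_preimage, hS, Set.mem_setOf_eq, coord_conj_glDiagonal e he t x] at hx
    rw [Set.mem_inv_smul_set_iff₀ hc0, Set.mem_preimage, hB, Set.mem_setOf_eq, smul_eq_mul]
    have hu' : ∀ j, (((((e (c * x) : ↥(unipotentRadicalGL F (id : Fin 2 → Fin 2))) : GL (Fin 2) F))⁻¹ : GL (Fin 2) F) : Matrix (Fin 2) (Fin 2) F) j j = 1 :=
      fun j => by rw [← Subgroup.coe_inv]; exact apply_self_eq_one_of_mem (e (c * x))⁻¹.2 j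
    exact fun i j => v_pow_mul_apply_le_one_of_adBall_mul_diagonal (coe_glDiagonal 2 F t) hu' hx i j
  -- count
  calc μN S = C * μF (e ⁻¹' S) := hread S
    _ ≤ C * μF (c⁻¹ • (e ⁻¹' B)) := mul_le_mul_right (measure_mono hsub) _
    _ = C * (normAbs F c⁻¹ * μF (e ⁻¹' B)) := by rw [addHaar_smul_set μF (inv_ne_zero hc0)]
    _ = normAbs F c⁻¹ * (C * μF (e ⁻¹' B)) := by ring
    _ ≤ ((normAbs F ((t 0 : F) - t 1))⁻¹ : ℝ≥0) * (C * μF (e ⁻¹' B)) := mul_le_mul_left (ENNReal.coe_le_coe.2 hcinv) _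
    _ = ((normAbs F ((t 0 : F) - t 1))⁻¹ : ℝ≥0) * μN B := by rw [hread B]

end Count

end Summit.HodgeConjecture.HodgeConjecture.Cruxes.H413.K2E3GL2SplitShearCount

end
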